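import Mathlib
import HarnessLib

/-!
# Norm uniformizers, `ord`, and the shell partition of `Fˣ` for a non-archimedean local field

Topic `NumberTheory/GaloisRepresentations`; namespace `Literature.NumberTheory.GaloisRepresentations.Ultrametric`
(the namespace of `UniformizerModulus.lean`, whose input "an element `ϖ` with `‖ϖ‖ < 1`" this file
produces), with the grouping sub-namespace `IsUniformizer` for dot-notation (`hϖ.ord`, `hϖ.iUnion_shell`).
Setting: a field `F` with a non-trivial non-archimedean absolute value (`[NontriviallyNormedField F]
[IsUltrametricDist F]`), locally compact where needed (`[ProperSpace F]`) — the NORM-side description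
of a non-archimedean local field used by analysis on `L²(F)` / `L²(Fⁿ)` (Haar measure, `distribHaarChar`),
as opposed to the valuation-side one (`IsNonarchimedeanLocalField`, `Valuation.IsUniformizer`) of
`LocalExistenceLubinTate.exists_isUniformizer` / `TateLocalFactors`. Contents:

* `IsUniformizer ϖ` (norm form): `‖ϖ‖ < 1` and every `y : Fˣ` has `‖y‖ = ‖ϖ‖ᵏ` for some `k : ℤ`;
  **existence** `exists_isUniformizer` for `[ProperSpace F]`, via Mathlib's
  `Valued.integer.isDiscreteValuationRing_of_compactSpace` for the norm-induced valuation
  (`NormedField.toValued`, scoped instance) — `isDiscreteValuationRing_integer`,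
  `exists_norm_eq_pow_of_norm_le_one`;
* the valuation `hϖ.ord : Fˣ →* Multiplicative ℤ` of a norm uniformizer (`norm_eq_zpow_ord`,
  `ord_self`, `ord_eq_one_iff : ord y = 1 ↔ ‖y‖ = 1`), through `ordFun : Fˣ → ℤ`;
* `‖x‖ < 1 → ‖x‖ ≤ ‖ϖ‖` (`norm_le_of_norm_lt_one`), i.e. `closedBall 0 ‖ϖ‖ = ball 0 1`
  (`closedBall_norm_eq_ball_one`): `ϖ𝒪` is the maximal ideal;
* the **shells** `shell ϖ k = {y : Fˣ | ‖y‖ = ‖ϖ‖ᵏ}`: `shell ϖ k = ord⁻¹{k}` (`mem_shell_iff_ord`), they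
  cover `Fˣ` (`iUnion_shell`), are pairwise disjoint (`pairwise_disjoint_shell`), closed, translates
  `shell ϖ k = ϖᵏ • shell ϖ 0` of `𝒪ˣ = shell ϖ 0` (`shell_eq_smul_shell_zero`), hence measurable and of
  equal left Haar measure (`measure_shell_eq`, for any Borel structure on `Fˣ`).

Standard: J.-P. Serre, *Local Fields* (1979), Ch. I §1 and Ch. II §1; J. W. S. Cassels, *Local Fields*
(1986), Ch. 4 [folklore]. Everything is proved (Mathlib only). Novelty check (`lean search --decl`,
2026-08-18): the tree has the valuation-side `exists_isUniformizer` (Lubin–Tate file, namespace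
`Literature.NumberTheory.GaloisRepresentations`, hypotheses `IsNonarchimedeanLocalField`) and
`UniformizerModulus` (`resIndex`, `distribHaarChar_uniformizer`, which ASSUME a `ϖ`); no norm-side
uniformizer / `ord` / shell partition. Deliberately NOT here: the residue cardinality
`[𝒪 : ϖ𝒪] = #(𝒪/𝔪)` and the module `δ(ϖ) = q⁻¹` (see `UniformizerModulus`), matrix coefficients.

## Provenance

Reproduced for the tree under the LEAN-IN-TREE rule (2026-08-18) from the pub-hodgecm cell's package
files `HodgeCM/PerL34/LocalFactors/DilationOrd.lean` (DAG-node prover #07 lineage, seat pv07 gen 2,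
gate run 25; 259 lines) and the shell block of `HodgeCM/PerL34/LocalFactors/DilationUnramified.lean`
(same seat, gate run 24: `shell`, `mem_shell_iff`, `zpow_mul_mem_shell`, `exists_eq_zpow_mul_of_norm_eq`),
statements and proofs verbatim except: universe-polymorphic `F : Type*`, the Borel structure on `Fˣ`
is a hypothesis `[MeasurableSpace Fˣ] [BorelSpace Fˣ]` instead of a local instance, docstrings / tags
added; port by seat pv07 gen 5.
-/

set_option autoImplicit false

noncomputable section

open MeasureTheory MeasureTheory.Measure Set Metric
open scoped NNReal ENNReal Pointwise

namespace Literature.NumberTheory.GaloisRepresentations.Ultrametric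

section Ord

variable {F : Type*} [NontriviallyNormedField F] [IsUltrametricDist F]

/-- **Uniformizer** (norm form): `‖ϖ‖ < 1` and the norm group of `Fˣ` is `‖ϖ‖^ℤ`. [folklore] -/
def IsUniformizer (ϖ : Fˣ) : Prop :=
  ‖(ϖ : F)‖ < 1 ∧ ∀ y : Fˣ, ∃ k : ℤ, ‖(y : F)‖ = ‖(ϖ : F)‖ ^ k

omit [IsUltrametricDist F] in
/-- Units of a normed field have positive norm. [folklore] -/
theorem norm_units_pos (y : Fˣ) : 0 < ‖(y : F)‖ := norm_pos_iff.mpr y.ne_zero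

/-! ### The shells `{‖y‖ = ‖ϖ‖ᵏ}` -/

/-- The shell `shell ϖ k = {y : Fˣ | ‖y‖ = ‖ϖ‖ᵏ}` (`= ϖᵏ𝒪ˣ`, `shell_eq_smul_shell_zero`). [folklore] -/
def shell (ϖ : Fˣ) (k : ℤ) : Set Fˣ := {y | ‖(y : F)‖ = ‖(ϖ : F)‖ ^ k}

omit [IsUltrametricDist F] in
/-- Membership in a shell, by definition. [folklore] -/
theorem mem_shell_iff (ϖ : Fˣ) (k : ℤ) (y : Fˣ) : y ∈ shell ϖ k ↔ ‖(y : F)‖ = ‖(ϖ : F)‖ ^ k :=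
  Iff.rfl

omit [IsUltrametricDist F] in
/-- `ϖᵏ u ∈ shell ϖ k` for a norm-one unit `u`. [folklore] -/
theorem zpow_mul_mem_shell (ϖ u : Fˣ) (hu : ‖(u : F)‖ = 1) (k : ℤ) : ϖ ^ k * u ∈ shell ϖ k := by
  rw [mem_shell_iff, Units.val_mul, Units.val_zpow_eq_zpow_val, norm_mul, norm_zpow, hu, mul_one]

omit [IsUltrametricDist F] in
/-- On the shell `‖y‖ = ‖ϖ‖ᵏ`: `y = ϖᵏ u` with `‖u‖ = 1`. [folklore] -/
theorem exists_eq_zpow_mul_of_norm_eq (ϖ y : Fˣ) (k : ℤ) (hy : ‖(y : F)‖ = ‖(ϖ : F)‖ ^ k) :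
    ∃ u : Fˣ, ‖(u : F)‖ = 1 ∧ y = ϖ ^ k * u := by
  refine ⟨ϖ ^ (-k) * y, ?_, by group⟩
  have hϖ : ‖(ϖ : F)‖ ≠ 0 := norm_ne_zero_iff.mpr ϖ.ne_zero
  rw [Units.val_mul, Units.val_zpow_eq_zpow_val, norm_mul, norm_zpow, hy, ← zpow_add₀ hϖ, neg_add_cancel,
    zpow_zero]

/-! ### Existence: the valuation ring of a local field is a DVR (Mathlib)

Only inside this section is the norm-induced `Valued F ℝ≥0` structure (`NormedField.toValued`) an
instance; `Valued.integer F` is the closed unit ball `𝒪 = {‖x‖ ≤ 1}` as a subring. -/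

section Existence

open scoped NormedField

/-- The valuation ring of the norm-induced valuation is the closed unit ball. [folklore] -/
theorem coe_integer_eq_closedBall : ((Valued.integer F : Subring F) : Set F) = closedBall (0 : F) 1 := by
  ext x; simp [Valued.integer.mem_iff]

/-- The closed unit ball of a locally compact normed field is compact. [folklore] -/
theorem compactSpace_integer [ProperSpace F] : CompactSpace (Valued.integer F) :=
  isCompact_iff_compactSpace.mp (by rw [coe_integer_eq_closedBall]; exact isCompact_closedBall _ _)

/-- The valuation ring `𝒪 = {‖x‖ ≤ 1}` of a locally compact non-trivially normed field is a discrete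
valuation ring (Mathlib: `Valued.integer.isDiscreteValuationRing_of_compactSpace`). [folklore] -/
theorem isDiscreteValuationRing_integer [ProperSpace F] : IsDiscreteValuationRing (Valued.integer F) := by
  haveI : CompactSpace (Valued.integer F) := compactSpace_integer
  haveI : (Valued.v : Valuation F ℝ≥0).IsNontrivial :=
    (inferInstance : (NormedField.valuation (K := F)).RankOne).toIsNontrivial
  exact Valued.integer.isDiscreteValuationRing_of_compactSpace

/-- Norms of integral elements: `x = u·ϖ₀ⁿ` with `‖u‖ = 1`, so `‖x‖ = ‖ϖ₀‖ⁿ`. [folklore] -/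
theorem exists_norm_eq_pow_of_norm_le_one [ProperSpace F] {ϖ₀ : Valued.integer F} (hirr : Irreducible ϖ₀)
    (y : F) (hy0 : y ≠ 0) (hy : ‖y‖ ≤ 1) : ∃ n : ℕ, ‖y‖ = ‖(ϖ₀ : F)‖ ^ n := by
  haveI := isDiscreteValuationRing_integer (F := F)
  have hmem : y ∈ Valued.integer F := Valued.integer.mem_iff.mpr hy
  have hne : (⟨y, hmem⟩ : Valued.integer F) ≠ 0 := fun h => hy0 (congrArg Subtype.val h)
  obtain ⟨n, u, hu⟩ := IsDiscreteValuationRing.eq_unit_mul_pow_irreducible hne hirr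
  refine ⟨n, ?_⟩
  have h := congrArg (fun z : Valued.integer F => ‖(z : F)‖) hu
  simp only at h
  rw [show ((((u : Valued.integer F) * ϖ₀ ^ n : Valued.integer F) : F)) = ((u : Valued.integer F) : F) * (ϖ₀ : F) ^ n by push_cast; rfl,
    norm_mul, norm_pow, Valued.integer.norm_coe_unit, one_mul] at h
  exact h

/-- **Every locally compact non-trivially normed ultrametric field has a uniformizer** (in the norm
sense). [folklore] -/
theorem exists_isUniformizer [ProperSpace F] : ∃ ϖ : Fˣ, IsUniformizer ϖ := by
  haveI := isDiscreteValuationRing_integer (F := F)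
  obtain ⟨ϖ₀, hirr⟩ := IsDiscreteValuationRing.exists_irreducible (Valued.integer F)
  have h0 : (ϖ₀ : F) ≠ 0 := fun h => hirr.ne_zero (Subtype.ext h)
  refine ⟨Units.mk0 (ϖ₀ : F) h0, Valued.integer.norm_irreducible_lt_one hirr, fun y => ?_⟩
  rw [Units.val_mk0]
  rcases le_or_gt ‖(y : F)‖ 1 with hy | hy
  · obtain ⟨n, hn⟩ := exists_norm_eq_pow_of_norm_le_one hirr (y : F) y.ne_zero hy
    exact ⟨n, by rw [zpow_natCast]; exact hn⟩
  · have hy' : ‖((y⁻¹ : Fˣ) : F)‖ ≤ 1 := by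
      rw [Units.val_inv_eq_inv_val, norm_inv]; exact inv_le_one_of_one_le₀ hy.le
    obtain ⟨n, hn⟩ := exists_norm_eq_pow_of_norm_le_one hirr ((y⁻¹ : Fˣ) : F) (y⁻¹).ne_zero hy'
    refine ⟨-(n : ℤ), ?_⟩
    rw [Units.val_inv_eq_inv_val, norm_inv] at hn
    rw [zpow_neg, zpow_natCast, ← hn, inv_inv]

end Existence

/-! ### `ord` -/

namespace IsUniformizer

variable {ϖ : Fˣ} (hϖ : IsUniformizer ϖ)
include hϖ

omit [IsUltrametricDist F] in
/-- A norm uniformizer has norm `< 1`. [folklore] -/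
theorem norm_lt_one : ‖(ϖ : F)‖ < 1 := hϖ.1

omit [IsUltrametricDist F] in
/-- `k ↦ ‖ϖ‖ᵏ` is injective. [folklore] -/
theorem zpow_injective : Function.Injective fun k : ℤ => ‖(ϖ : F)‖ ^ k :=
  zpow_right_injective₀ (norm_units_pos ϖ) hϖ.norm_lt_one.ne

omit [IsUltrametricDist F] in
/-- `ord y`: there is a unique `k` with `‖y‖ = ‖ϖ‖ᵏ`. [folklore] -/
theorem existsUnique_norm_eq_zpow (y : Fˣ) : ∃! k : ℤ, ‖(y : F)‖ = ‖(ϖ : F)‖ ^ k := by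
  obtain ⟨k, hk⟩ := hϖ.2 y
  exact ⟨k, hk, fun k' hk' => hϖ.zpow_injective (hk'.symm.trans hk)⟩

/-- The valuation `ord : Fˣ → ℤ` attached to the uniformizer, as a bare function. [folklore] -/
def ordFun (y : Fˣ) : ℤ := (hϖ.2 y).choose

omit [IsUltrametricDist F] in
/-- `‖y‖ = ‖ϖ‖ ^ ord y`. [folklore] -/
theorem norm_eq_zpow_ordFun (y : Fˣ) : ‖(y : F)‖ = ‖(ϖ : F)‖ ^ hϖ.ordFun y := (hϖ.2 y).choose_spec

omit [IsUltrametricDist F] in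
/-- `ord y = k ↔ ‖y‖ = ‖ϖ‖ᵏ`. [folklore] -/
theorem ordFun_eq_iff (y : Fˣ) (k : ℤ) : hϖ.ordFun y = k ↔ ‖(y : F)‖ = ‖(ϖ : F)‖ ^ k :=
  ⟨fun h => h ▸ hϖ.norm_eq_zpow_ordFun y,
    fun h => hϖ.zpow_injective ((hϖ.norm_eq_zpow_ordFun y).symm.trans h)⟩

omit [IsUltrametricDist F] in
/-- `ord` is additive. [folklore] -/
theorem ordFun_mul (y z : Fˣ) : hϖ.ordFun (y * z) = hϖ.ordFun y + hϖ.ordFun z := by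
  rw [ordFun_eq_iff, Units.val_mul, norm_mul, hϖ.norm_eq_zpow_ordFun y, hϖ.norm_eq_zpow_ordFun z,
    zpow_add₀ (norm_units_pos ϖ).ne']

omit [IsUltrametricDist F] in
/-- `ord 1 = 0`. [folklore] -/
theorem ordFun_one : hϖ.ordFun 1 = 0 := by
  rw [ordFun_eq_iff, Units.val_one, norm_one, zpow_zero]

omit [IsUltrametricDist F] in
/-- `ord ϖ = 1`. [folklore] -/
theorem ordFun_self : hϖ.ordFun ϖ = 1 := by
  rw [ordFun_eq_iff, zpow_one]

/-- **`ord : Fˣ →* Multiplicative ℤ`**, the valuation of the uniformizer as a monoid hom. [folklore] -/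
def ord : Fˣ →* Multiplicative ℤ where
  toFun y := Multiplicative.ofAdd (hϖ.ordFun y)
  map_one' := by rw [hϖ.ordFun_one]; rfl
  map_mul' y z := by rw [hϖ.ordFun_mul, ofAdd_add]

omit [IsUltrametricDist F] in
/-- `ord` and `ordFun` agree. [folklore] -/
theorem toAdd_ord (y : Fˣ) : (hϖ.ord y).toAdd = hϖ.ordFun y := rfl

omit [IsUltrametricDist F] in
/-- `‖y‖ = ‖ϖ‖ ^ ord y` (monoid-hom form). [folklore] -/
theorem norm_eq_zpow_ord (y : Fˣ) : ‖(y : F)‖ = ‖(ϖ : F)‖ ^ (hϖ.ord y).toAdd := hϖ.norm_eq_zpow_ordFun y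

omit [IsUltrametricDist F] in
/-- `ord ϖ = 1` (monoid-hom form). [folklore] -/
theorem ord_self : hϖ.ord ϖ = Multiplicative.ofAdd 1 := by
  change Multiplicative.ofAdd (hϖ.ordFun ϖ) = _; rw [hϖ.ordFun_self]

omit [IsUltrametricDist F] in
/-- `ker ord = 𝒪ˣ = {‖u‖ = 1}`. [folklore] -/
theorem ord_eq_one_iff (y : Fˣ) : hϖ.ord y = 1 ↔ ‖(y : F)‖ = 1 := by
  change Multiplicative.ofAdd (hϖ.ordFun y) = Multiplicative.ofAdd 0 ↔ _
  rw [Multiplicative.ofAdd.apply_eq_iff_eq, ordFun_eq_iff, zpow_zero]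

omit [IsUltrametricDist F] in
/-- The norm shells are the fibres of `ord`: `shell ϖ k = ord⁻¹{k}`. [folklore] -/
theorem mem_shell_iff_ord (k : ℤ) (y : Fˣ) : y ∈ shell ϖ k ↔ (hϖ.ord y).toAdd = k := by
  rw [mem_shell_iff, toAdd_ord, ordFun_eq_iff]

omit [IsUltrametricDist F] in
/-- `shell ϖ k = ord⁻¹{k}` as a set identity. [folklore] -/
theorem shell_eq_ord_preimage (k : ℤ) : shell ϖ k = {y | (hϖ.ord y).toAdd = k} :=
  Set.ext fun y => hϖ.mem_shell_iff_ord k y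

omit [IsUltrametricDist F] in
/-- The shells cover `Fˣ`. [folklore] -/
theorem iUnion_shell : (⋃ k : ℤ, shell ϖ k) = univ :=
  eq_univ_of_forall fun y => mem_iUnion.mpr ⟨hϖ.ordFun y, hϖ.norm_eq_zpow_ordFun y⟩

omit [IsUltrametricDist F] in
/-- `‖x‖ < 1 → ‖x‖ ≤ ‖ϖ‖`: `ϖ𝒪 = {‖x‖ ≤ ‖ϖ‖}` is the maximal ideal `{‖x‖ < 1}` (so `[𝒪 : ϖ𝒪]` is the
residue cardinality). [folklore] -/
theorem norm_le_of_norm_lt_one (x : F) (hx : ‖x‖ < 1) : ‖x‖ ≤ ‖(ϖ : F)‖ := by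
  by_cases hx0 : x = 0
  · rw [hx0, norm_zero]; exact (norm_nonneg _)
  · obtain ⟨k, hk⟩ := hϖ.2 (Units.mk0 x hx0)
    rw [Units.val_mk0] at hk
    rw [hk] at hx ⊢
    have hk1 : 0 < k := (zpow_lt_one_iff_right_of_lt_one₀ (norm_units_pos ϖ) hϖ.norm_lt_one).mp hx
    calc ‖(ϖ : F)‖ ^ k ≤ ‖(ϖ : F)‖ ^ (1 : ℤ) :=
          zpow_le_zpow_right_of_le_one₀ (norm_units_pos ϖ) hϖ.norm_lt_one.le (by omega)
      _ = ‖(ϖ : F)‖ := zpow_one _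

omit [IsUltrametricDist F] in
/-- `closedBall 0 ‖ϖ‖ = ball 0 1`: the maximal ideal is `ϖ𝒪`. [folklore] -/
theorem closedBall_norm_eq_ball_one : closedBall (0 : F) ‖(ϖ : F)‖ = ball (0 : F) 1 := by
  ext x
  rw [mem_closedBall_zero_iff, mem_ball_zero_iff]
  exact ⟨fun h => h.trans_lt hϖ.norm_lt_one, hϖ.norm_le_of_norm_lt_one x⟩

end IsUniformizer

/-! ### The shell partition: disjoint, closed, translates of `𝒪ˣ`, equal Haar measure -/

omit [IsUltrametricDist F] in
/-- The shells of an element of norm `< 1` are pairwise disjoint. [folklore] -/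
theorem pairwise_disjoint_shell (ϖ : Fˣ) (hϖ : ‖(ϖ : F)‖ < 1) :
    Pairwise (Function.onFun Disjoint (shell ϖ)) := by
  intro k l hkl
  change Disjoint (shell ϖ k) (shell ϖ l)
  rw [Set.disjoint_left]
  intro y hk hl
  rw [mem_shell_iff] at hk hl
  exact hkl (zpow_right_injective₀ (norm_units_pos ϖ) hϖ.ne (hk.symm.trans hl))

omit [IsUltrametricDist F] in
/-- Shells are closed in `Fˣ`. [folklore] -/
theorem isClosed_shell (ϖ : Fˣ) (k : ℤ) : IsClosed (shell ϖ k) :=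
  isClosed_eq (continuous_norm.comp Units.continuous_val) continuous_const

omit [IsUltrametricDist F] in
/-- `shell ϖ k = ϖᵏ • 𝒪ˣ` with `𝒪ˣ = shell ϖ 0`. [folklore] -/
theorem shell_eq_smul_shell_zero (ϖ : Fˣ) (k : ℤ) : shell ϖ k = ϖ ^ k • shell ϖ 0 := by
  ext y
  rw [Set.mem_smul_set]
  constructor
  · intro hy
    obtain ⟨u, hu, rfl⟩ := exists_eq_zpow_mul_of_norm_eq ϖ y k hy
    exact ⟨u, by rw [mem_shell_iff, zpow_zero]; exact hu, rfl⟩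
  · rintro ⟨u, hu, rfl⟩
    rw [mem_shell_iff, zpow_zero] at hu
    exact zpow_mul_mem_shell ϖ u hu k

omit [IsUltrametricDist F] in
/-- Shells are measurable (for the Borel structure on `Fˣ`). [folklore] -/
theorem measurableSet_shell [MeasurableSpace Fˣ] [BorelSpace Fˣ] (ϖ : Fˣ) (k : ℤ) :
    MeasurableSet (shell ϖ k) :=
  (isClosed_shell ϖ k).measurableSet

omit [IsUltrametricDist F] in
/-- All shells have the left Haar measure of `𝒪ˣ = shell ϖ 0` (left invariance only). [folklore] -/
theorem measure_shell_eq [MeasurableSpace Fˣ] [BorelSpace Fˣ] (μG : Measure Fˣ) [μG.IsMulLeftInvariant]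
    (ϖ : Fˣ) (k : ℤ) : μG (shell ϖ k) = μG (shell ϖ 0) := by
  rw [shell_eq_smul_shell_zero ϖ k, measure_smul]

end Ord

end Literature.NumberTheory.GaloisRepresentations.Ultrametric

end
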